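import Literature.AnabelianGeometry.EtaleTheta.SettingModelChiCuspInertiaNotTheta
import Literature.AnabelianGeometry.EtaleTheta.Discharge.Sec2InertiaClauseLevelZero
import HarnessLib

/-!
# The χ-twisted model WITH a cusp (`curveχ′`): the Θ-LEVEL inertia clause «`I_x ↠ Δ_Θ ⊆ Δ^Θ_X`» FAILS too

S. Mochizuki, *The étale theta function and its Frobenioid-theoretic manifestations*, Publ. RIMS **45**
(2009) [EtTh], §2, discussion preceding Def. 2.1, PRIMS p. 261 (PDF p. 35): «`D_x → Π^Θ_X` … maps the
inertia group `I_x ⊆ D_x` isomorphically onto `Δ_Θ`» [cite: MochizukiEtTh2009, Def 2.1 p.35].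

Cell abc-iut, layer L2, seat abc-iut-w6-d077 (gen 2); census input for the v-next «inertia generates `Δ_Θ`»
field (GAP-LEDGER G-L2t10-3). abc-iut-L2-t10's `SettingModelChiCuspInertiaNotTheta` (p433801) refutes the
per-`l` clause `toHat(I_x) ⊔ barKerOf Δ_X l = barThetaOf Δ_X l` at the only cusp datum of the tree
(abc-iut-w5-d029's `curveχ′`, synthetic TORAL inertia `b^Ẑ`) for every `l ≥ 2`. By the `l = 0` reading of
`Discharge/Sec2InertiaClauseLevelZero` (`ClassTwoBar.barThetaOf_zero`: `barThetaOf Δ 0 = [Δ,Δ]⁻`, the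
`Δ_Θ`-preimage, `barKerOf Δ 0 = [Δ,[Δ,Δ]]⁻ = Ker(Δ ↠ Δ^Θ)`) the same toral witness refutes the Θ-LEVEL
(Heisenberg-quotient, print's own) shape of the clause. PROOF-ONLY, 0 definitions, nothing restated:

* `ClassTwoBar.barThetaOf_zero_le` — `barThetaOf Δ 0 ≤ barThetaOf Δ l` for every `l`;
* `SettingModel.not_map_inertia_le_barThetaOf_zero_curveχ'` — `toHat(I_x) ≰ [Δ_X,Δ_X]⁻`;
* **`SettingModel.not_inertiaClause_zero_curveχ'`** (and the closure form) — `¬ (toHat(I_x) ⊔ barKerOf Δ_X 0 =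
  barThetaOf Δ_X 0)`: the synthetic inertia does NOT map onto `Δ_Θ` in `Δ^Θ_X = Δ_X/[Δ_X,[Δ_X,Δ_X]]`;
* `SettingModel.exists_cusp_thetaLevelClause_fails` — census summary at the Θ-level.

So at `curveχ′` none of the candidate shapes (commutator axis, Θ-level, per-`l` for `l ≥ 2`) holds: a v-next
field in any of these shapes is a genuinely new axiom there. HONEST LIMITS: semi-synthetic model, consistency
evidence only; nothing of [EtTh] is asserted or refuted; no side is taken on [IUTchIII] Cor. 3.12; typed ≠ proved.
-/

noncomputable section

namespace Literature.AnabelianGeometry.EtaleTheta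

open scoped commutatorElement
open Literature.AnabelianGeometry.SemiGraphs _root_.Topology

namespace ClassTwoBar

variable {G : Type*} [Group G] [TopologicalSpace G] [IsTopologicalGroup G] (Δ : Subgroup G)

/-- `barThetaOf Δ 0 = [Δ,Δ]⁻ ≤ barThetaOf Δ l` for every `l` (the `Δ_Θ`-preimage lies in every
`Δ̄_Θ`-preimage). [cite: MochizukiEtTh2009, Def 2.1 p.35] -/
theorem barThetaOf_zero_le (l : ℕ) : barThetaOf Δ 0 ≤ barThetaOf Δ l := by
  rw [barThetaOf_zero]
  exact Subgroup.topologicalClosure_minimal _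
    (le_sup_left.trans (Subgroup.le_topologicalClosure _)) (isClosed_barThetaOf Δ l)

/-- `barKerOf Δ 0 = [Δ,[Δ,Δ]]⁻ ≤ barKerOf Δ l` for every `l`. [cite: MochizukiEtTh2009, Def 2.1 p.35] -/
theorem barKerOf_zero_le (l : ℕ) : barKerOf Δ 0 ≤ barKerOf Δ l := by
  rw [barKerOf_zero]
  exact Subgroup.topologicalClosure_minimal _
    (le_sup_left.trans (Subgroup.le_topologicalClosure _)) (isClosed_barKerOf Δ l)

end ClassTwoBar

namespace SettingModel

open ClassTwoBar

variable (p : ℕ) [Fact p.Prime]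

/-- **The synthetic inertia is not inside the `Δ_Θ`-preimage**: `toHat(I_x) ≰ [Δ_X,Δ_X]⁻ = barThetaOf Δ_X 0`
for the cusp of `curveχ′` (the `b`-axis maps NON-trivially to `Δ^ell_X = Δ^ab_X`; via abc-iut-L2-t10's
`not_map_inertia_le_barThetaOf_curveχ'` at `l = 2` and `barThetaOf_zero_le`). [cite: MochizukiEtTh2009, Def 2.1 p.35] -/
theorem not_map_inertia_le_barThetaOf_zero_curveχ' (x : (curveχ' p).Pt) :
    ¬ ((curveχ' p).inertia x).map (curveχ' p).toHat.toMonoidHom ≤ barThetaOf (curveχ' p).DeltaHat 0 :=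
  fun h => not_map_inertia_le_barThetaOf_curveχ' p 2 le_rfl x (h.trans (barThetaOf_zero_le _ 2))

/-- **KERNEL CERTIFICATE at the Θ-level.** At the only cusp datum of the tree (`curveχ′`, toral inertia
`b^Ẑ`), print's Θ-level clause «`I_x` maps onto `Δ_Θ ⊆ Δ^Θ_X`» — in the tree's recipe
`toHat(I_x) ⊔ barKerOf Δ_X 0 = barThetaOf Δ_X 0`, i.e. `toHat(I_x) · [Δ_X,[Δ_X,Δ_X]]⁻ = [Δ_X,Δ_X]⁻` — is FALSE.
[cite: MochizukiEtTh2009, Def 2.1 p.35] -/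
theorem not_inertiaClause_zero_curveχ' (x : (curveχ' p).Pt) :
    ¬ (((curveχ' p).inertia x).map (curveχ' p).toHat.toMonoidHom ⊔ barKerOf (curveχ' p).DeltaHat 0 =
        barThetaOf (curveχ' p).DeltaHat 0) :=
  fun h => not_map_inertia_le_barThetaOf_zero_curveχ' p x (le_sup_left.trans h.le)

/-- The same in the explicit closure vocabulary: `¬ (toHat(I_x) ⊔ [Δ_X,[Δ_X,Δ_X]]⁻ = [Δ_X,Δ_X]⁻)`.
[cite: MochizukiEtTh2009, Def 2.1 p.35] -/
theorem not_inertia_sup_tripleCommutatorClosure_curveχ' (x : (curveχ' p).Pt) :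
    ¬ (((curveχ' p).inertia x).map (curveχ' p).toHat.toMonoidHom ⊔
          (⁅⁅(curveχ' p).DeltaHat, (curveχ' p).DeltaHat⁆, (curveχ' p).DeltaHat⁆).topologicalClosure =
        (⁅(curveχ' p).DeltaHat, (curveχ' p).DeltaHat⁆).topologicalClosure) := by
  rw [← barKerOf_zero, ← barThetaOf_zero]
  exact not_inertiaClause_zero_curveχ' p x

/-- The same with the closure of `toHat(I_x)` (non-compact form). [cite: MochizukiEtTh2009, Def 2.1 p.35] -/
theorem not_inertiaClause_closure_zero_curveχ' (x : (curveχ' p).Pt) :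
    ¬ ((((curveχ' p).inertia x).map (curveχ' p).toHat.toMonoidHom).topologicalClosure ⊔
          barKerOf (curveχ' p).DeltaHat 0 = barThetaOf (curveχ' p).DeltaHat 0) :=
  fun h => not_map_inertia_le_barThetaOf_zero_curveχ' p x
    ((Subgroup.le_topologicalClosure _).trans (le_sup_left.trans h.le))

/-- Census summary at the Θ-level: at `curveχ′` the cusp EXISTS with inertia `≅ Ẑ` (the typed clause
`inertia_equiv_zHat` holds), yet its inertia does NOT map onto `Δ_Θ ⊆ Δ^Θ_X` — the `TemperedCurve` interface
does not determine the position of the inertia in `Δ_X` at the Heisenberg quotient either.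
[cite: MochizukiEtTh2009, Def 2.1 p.35] -/
theorem exists_cusp_thetaLevelClause_fails :
    ∃ x : (curveχ' p).Pt, (curveχ' p).IsCusp x ∧
      Nonempty (↥((curveχ' p).decomp x ⊓ (curveχ' p).aug.toMonoidHom.ker) ≃ₜ* ZHat) ∧
      ¬ (((curveχ' p).inertia x).map (curveχ' p).toHat.toMonoidHom ⊔ barKerOf (curveχ' p).DeltaHat 0 =
          barThetaOf (curveχ' p).DeltaHat 0) :=
  ⟨(), trivial, (curveχ' p).inertia_equiv_zHat () trivial, not_inertiaClause_zero_curveχ' p ()⟩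

end SettingModel

end Literature.AnabelianGeometry.EtaleTheta

end
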